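import Summits.NavierStokesRegularity.NavierStokesRegularity.Theorems.IncrementDoorsDefs
import Summits.NavierStokesRegularity.NavierStokesRegularity.Theorems.ArgmaxNearDoorsSplit
import Summits.NavierStokesRegularity.NavierStokesRegularity.Theorems.IncrementDoorsProfile
import HarnessLib

/-!
# IncrementDoorsPlates — door S36-K «IncrementDoor» (nsreg-p1 ROUND-34 §B): plates D♯ and P BY NAME

S-door lane (ns-sfl-p1 g5; LEAD ns-s30-p1 g3; texts of record nsreg-p1 g30 `r34/Sketch36.lean` sha16
f0fe6d26e287c4b8 = tree P0-36B `Theorems/IncrementDoorsDefs.lean` p653623; `--supports stmt-NavierStokesRegularity-0056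
--as helper`). The two S-plates of §B against P0's Prop names, by `exact` from the δ-unfolded theorems already in
the tree:

* `nearFarSplit_holds : NearFarSplit` (D♯; `ArgmaxDoors.nearFarSplit`, `Theorems/ArgmaxNearDoorsSplit.lean` p652373);
* `modulusProfileExists_holds : ModulusProfileExists` (P; `IncrementDoors.modulusProfileExists`,
  `Theorems/IncrementDoorsProfile.lean` p652407 — the explicit unbounded KNV profile).

With D `pointDepletion_holds` (p646609) and F in P0-35, door S36-K closes by `incrementDoor_of` modulo the ONE
un-keyed L-plate K «IncrementEngine» (planner's HOLD).

WHAT THIS IS NOT: plates of a TWO-POINT regularity CRITERION about hypothetical blow-up; item 0056 `NoTypeII` and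
NS regularity are NOT proved; nothing here is a route or a summit statement.
-/

-- the summit's problem namespace repeats the summit name (tree layout)
set_option linter.dupNamespace false

noncomputable section

namespace Summit.NavierStokesRegularity.NavierStokesRegularity.Theorems.IncrementDoors

open Summit.NavierStokesRegularity.NavierStokesRegularity.Theorems.ArgmaxDoors

/-- plate D♯ «NearFarSplit» of door S36-K BY NAME (P0 `IncrementDoorsDefs`): under a Lipschitz bound on `B(x,r)` the
depletion integral splits as `depletionIntegral ≤ 4πrΛ + farDepletionIntegral`. -/
theorem nearFarSplit_holds : NearFarSplit :=
  nearFarSplit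

/-- plate P «ModulusProfileExists» of door S36-K BY NAME (P0 `IncrementDoorsDefs`): the admissible modulus
profile class `IsModulusProfile` is non-empty (explicit witness in `IncrementDoorsProfile`). -/
theorem modulusProfileExists_holds : ModulusProfileExists :=
  modulusProfileExists

end Summit.NavierStokesRegularity.NavierStokesRegularity.Theorems.IncrementDoors

end
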